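import Literature.MathematicalPhysics.QuantumFieldTheory.ConformalBootstrap3D.PointKernelK34L515.Cert

/-!
# K34L515 instance, cell `l6c4` (parts file: groups 0:28)

Kernel-v3 cell of the point-functional exclusion instance for the lower box `Δσ ∈ [0.515, 0.520]`,
`Δε ∈ [0.6, 0.95)` (certificate `certL515`, module `PointKernelK34L515.Cert`): spin `ℓ = 6`,
`Δ ∈ [119/16, 239/32)` (centre `A`, half-width `2^-6`), Taylor degree `3`, `n_F = 50`, `1` s-piece(s)
covering `s = Δσ ∈ [103/200, 13/25]`.  Group theorems `l6c4_part<i>_<a>_<b> : gPart … = some <literal>` are checked by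
`decide +kernel` (the literals were produced by `#eval` of the same function); the cell numbers `l6c4_num<i> ≥ 0`
likewise; `l6c4_block` is `PKTM.blockPositive_of_cellPass` applied to them. This file holds only group theorems (the cell stated as a literal); the final file of the cell imports it.  Generated by
`gen/mk_v3cell.py` / `gen/drive_v3.py` (typer-g8).  [folklore]
-/

set_option Elab.async false

namespace Literature.MathematicalPhysics.QuantumFieldTheory.ConformalBootstrap3D

namespace PointKernelK34L515

open PointKernel PKTM
open Literature.Analysis.ValidatedNumerics.PolyMP
open Literature.Analysis.ValidatedNumerics.NumericsMP

/-- group model literal [folklore] -/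
def l6c4_g0_28_34 : G3 := ([⟨489221146329973745007207340762906384623, 489221147464298787546021315353999871128⟩, ⟨16021736754452305887736287383820655666, 16021737647808355900609454816406285350⟩, ⟨2698367724101161882799241446607210460, 2698368681395121769942136623985517960⟩, ⟨2359296226953223940888964257318293365, 2359297096928712062293893943695850970⟩], [⟨-5753721215797570320345606330726395930, -5753721203042993777259553764465736218⟩, ⟨-241122891120046035345453103452118276, -241122880864021671720400830480477835⟩, ⟨-42780859071556850707286775770229117, -42780848050308184031227159640395272⟩, ⟨-23772177038549693328288173214639067, -23772166991698453698174510690327250⟩], [⟨35202384659201167428709095651997047, 35202384732040430106846153285310274⟩, ⟨1796395830377366529597511132956405, 1796395889688219098358378012443373⟩, ⟨269835311327317064165334505372090, 269835375253347593076895098716052⟩, ⟨133443939095172518477271704244632, 133443997556287900177576400553581⟩])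

/-- group `[28, 34)` of piece 0 [folklore] -/
theorem l6c4_part0_28_34 : gPart certL515 (⟨6, ((477 : ℚ) / 64), 6, 3, 50, 6, 64, ⟨3, 0, 5, 93, 0, 0⟩⟩ : TMCell) (pc ps1 0) 28 34 = some l6c4_g0_28_34 := by decide +kernel

end PointKernelK34L515

end Literature.MathematicalPhysics.QuantumFieldTheory.ConformalBootstrap3D
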